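import Summits.RiemannHypothesis.RiemannHypothesis.Theses.LiHeightLog
import Summits.RiemannHypothesis.RiemannHypothesis.Theorems.LiHeightLogLiBoxCoshPair
import HarnessLib

/-!
# RiemannHypothesis / LiHeightLog — item `LiBoxCosh` (crux K1⁺) — PROVED (RH-FREE given the verified height)

Route `RiemannHypothesis/LiHeightLog` (round 6, rung L-P(P1-log) «Li HEIGHT LAW, LOGARITHMIC RANGE», cell `pub/rh-li`),
item `LiBoxCosh` (stmt-RiemannHypothesis-19648): `liBoxCosh_proof`, by the explicit cosh box comparison
`liBoxCosh_bound` of `LiHeightLogLiBoxCoshPair.lean` (K1b bookkeeping `re_boxSum_eq`, on-line exactness below the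
verified height, the cosh pair lemma `pair_cosh` above it).  For RH verified to `T ≥ 4`, `T ≤ T'` and EVERY `n`:

  `|Re Σ_{ρ ∈ liZeroBox T'} m(1 − (1 − 1/ρ)ⁿ) − 2 Σ_{0 < Im ρ ≤ T'} m f_n(Im ρ)|
      ≤ Σ_{T < Im ρ ≤ T'} m·liCoshWeight n (Im ρ) + (n/2) Σ_{T < Im ρ ≤ T'} m/(Im ρ)³`.

Nothing here bears on the truth of RH: the only hypothesis is the FINITE verified height `RiemannHypothesisUpTo T`.
-/

noncomputable section

-- D-0017: `Summit.<S>.<S>.…` is the designed namespace of a single-problem summit.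
set_option linter.dupNamespace false

namespace Summit.RiemannHypothesis.RiemannHypothesis.Theorems.LiTheory

/-- **Item `LiBoxCosh` of route `LiHeightLog` — PROVED** (FQ type, by name; RH-free apart from the verified height). -/
theorem liBoxCosh_proof :
    Summit.RiemannHypothesis.RiemannHypothesis.Theses.LiHeightLog.LiBoxCosh :=
  liBoxCosh_bound

end Summit.RiemannHypothesis.RiemannHypothesis.Theorems.LiTheory

end
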